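/-
Copyright (c) 2026 the pub-hodgecm-mathlib formalisation cell (harness21).  Prover seat hodgecm-mathlib-K2Liu-p09 (g5): Track B «K2-LIT»,
hLiu418 = stmt-HodgeConjecture-24832; LEAD F0P6-plan (g12) RULINGS M-156m∕M-156o «A7 = GK COCYCLE ROAD», file B7-prep.
-/
import Summits.HodgeConjecture.HodgeConjecture.Theorems.K2LiuQRationalLFactor       -- ★ (a): regularity of `lF`, `lEN`, `bDen` at `½`, `lF_ne_zero`
import HarnessLib

/-!
# Crux `HLiu418`, road `K2_Liu`, organ A7-reg (GK cocycle road), file B7-prep: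
# THE NORMALISER ALGEBRA — `a_w(s) · Fn = L₁ L₂ L₃ · G` with `Fn := vol⁻¹ · b_2(s) · L_F(2s+1,χ_F) · L_F(2s,χ_F) · G`, and `Fn` regular at `½`

Cell `hodgecm-mathlib`, crux item hLiu418 = `stmt-HodgeConjecture-24832`; squad K2 ∕ K2Liu; prover K2Liu-p09 (g5).
THEOREMS ONLY (no `def`, no instance, no notation, no named-fact hypothesis, no `sorry`); lane `--supports stmt-HodgeConjecture-24832`
(count-neutral helper).  Pure algebra on ★ T1 `K2LiuLocalLFactorDefs` (`aNorm`, `aNum`, `bDen`, `gkFactor`, `lF`, `lEN`) and ★ (a) `K2LiuQRationalLFactor`.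

THE BOOKKEEPING OF A7-reg (census §3 ∕ RULING M-156m (1)).  The cocycle gives `M_w(s) f_s(h) = c · L₁(s) L₂(s) L₃(s) · G(s,h)` with the three
rank-one numerators `L₁ = L_F(2s+1, χ_F) = lF (2s+1)`, `L₂ = L_{E/F}(2s, χ_F∘N) = lEN (2s)`, `L₃ = L_F(2s−1, χ_F) = lF (2s−1)` and `G` regular at `½`
(★ `K2LiuRankOneOperators`, ★ `K2LiuRankOneFamilies`).  The fixed normaliser is `a_w(s) = aNorm 2 χ_v vol s = vol · a_2(s)/b_2(s)` with
`a_2(s) = lF(2s−1) · lEN(2s)/lF(2s)` (★ `aNorm_two`).  Hence, on the convergence half-plane,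
  `M_w(s) f_s(h) = a_w(s) · Fn(s,h)`,   `Fn(s,h) := vol⁻¹ · b_2(s) · lF(2s+1) · lF(2s) · (c · G(s,h))`,
and `Fn` is REGULAR AT `½` for unitary `χ_v` (★ (a): `b_2`, `lF(2s+1)`, `lF(2s)` are; the pole of `L₃ = lF(2s−1)` went into `a_w`).
* §1 `aNorm_two_mul_normalisedFactor` — the identity `aNorm 2 χv vol s * (vol⁻¹ * bDen 2 s * lF(2s+1) * lF(2s) * X) = lF(2s+1) * lEN(2s) * lF(2s−1) * X`
  under `vol ≠ 0`, `bDen 2 χv s ≠ 0`, `lF χv (2s) ≠ 0`;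
* §2 these non-vanishings on `−½ < re s` for unitary `χ_v` (`bDen_two_ne_zero`, from ★ `lF_ne_zero` ∕ `lFactor_ne_zero`);
* §3 `isQRationalRegularAt_normalisedFactor` — `s ↦ vol⁻¹ · bDen 2 s · lF(2s+1) · lF(2s) · X s` is regular at `½` when `X` is.
HONEST LABEL.  `HC_CM` is proved only modulo the 7 printed citations (2 remaining named inputs: hLiu418 = `stmt-HodgeConjecture-24832`,
h413 = `stmt-HodgeConjecture-24833`) until rung 0 closes.

## References
* [HarrisKudlaSweet1996] M. Harris, S. Kudla, W. J. Sweet, J. AMS 9 (1996), §6 (6.14)–(6.16) (`a_n`, `b_n`, the Gindikin–Karpelevich product).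
* [KudlaSweet1997] S. Kudla, W. J. Sweet, Israel J. Math. 98 (1997), §1 (the normalised intertwining operator).
* [Casselman1980] W. Casselman, Compositio Math. 40 (1980), §3 Thm. 3.1 (the product of rank-one factors).
-/

set_option autoImplicit false
set_option linter.dupNamespace false -- the mandated namespace repeats `HodgeConjecture.HodgeConjecture`

noncomputable section

open NumberField IsDedekindDomain
open Literature.NumberTheory.GaloisRepresentations.IsNonarchimedeanLocalField
open Literature.NumberTheory.Automorphic Literature.NumberTheory.Automorphic.UnitaryGroup
open Summit.HodgeConjecture.HodgeConjecture.Cruxes.HLiu418.K2LiuQRationalDefs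
open Summit.HodgeConjecture.HodgeConjecture.Cruxes.HLiu418.K2LiuLocalLFactorDefs
open Summit.HodgeConjecture.HodgeConjecture.Cruxes.HLiu418.K2LiuQRationalLFactor

namespace Summit.HodgeConjecture.HodgeConjecture.Cruxes.HLiu418.K2LiuA7NormaliserAlgebra

variable {F : Type} [Field F] [NumberField F] {E : Type} [Field E] [NumberField E] [Algebra F E]
  (c : E ≃ₐ[F] E) {v : HeightOneSpectrum (𝓞 F)} (χv : ∀ w : PlacesOver E v, (w.1.adicCompletion E)ˣ →* ℂˣ)

/-! ## §1 The identity `a_w · Fn = L₁ L₂ L₃ · X` -/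

/-- `a_2(s) = lF(2s−1) · (lEN(2s) / lF(2s))` (unfolding ★ `aNum` at `n = 2`). [cite: HarrisKudlaSweet1996, §6 (6.16)] -/
theorem aNum_two (s : ℂ) :
    aNum F E c v 2 χv s = lF F E v χv (2 * s - 1) * (lEN F E c v χv (2 * s) / lF F E v χv (2 * s)) := by
  rw [aNum]
  simp only [Finset.prod_range_succ, Finset.prod_range_zero, one_mul, gkFactor_of_even F E c v χv Even.zero,
    gkFactor_of_odd F E c v χv odd_one, Nat.cast_ofNat, Nat.cast_zero, Nat.cast_one, add_zero]
  rw [show (2 : ℂ) * s - 2 + 1 = 2 * s - 1 by ring, show (2 : ℂ) * s + 1 - 2 + 1 = 2 * s by ring]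

/-- `b_2(s) = lF(2s+2) · (lEN(2s+1) / lF(2s+1))` (unfolding ★ `bDen` at `n = 2`). [cite: HarrisKudlaSweet1996, §6 (6.16)] -/
theorem bDen_two (s : ℂ) :
    bDen F E c v 2 χv s = lF F E v χv (2 * s + 2) * (lEN F E c v χv (2 * s + 1) / lF F E v χv (2 * s + 1)) := by
  rw [bDen]
  simp only [Finset.prod_range_succ, Finset.prod_range_zero, one_mul, gkFactor_of_even F E c v χv Even.zero,
    gkFactor_of_odd F E c v χv odd_one, Nat.cast_ofNat, Nat.cast_zero, Nat.cast_one, sub_zero]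
  rw [show (2 : ℂ) * s + 2 - 1 = 2 * s + 1 by ring]

/-- **`a_w(s) · Fn = L₁ L₂ L₃ · X`**: with `Fn = vol⁻¹ · b_2(s) · lF(2s+1) · lF(2s) · X`,
`aNorm 2 χv vol s · Fn = lF(2s+1) · lEN(2s) · lF(2s−1) · X` (needs `vol ≠ 0`, `b_2(s) ≠ 0`, `lF(2s) ≠ 0`).
[cite: HarrisKudlaSweet1996, §6 (6.14)–(6.16)] [cite: Casselman1980, §3 Thm. 3.1] -/
theorem aNorm_two_mul_normalisedFactor {vol : ℝ} (hvol : vol ≠ 0) {s : ℂ} (hb : bDen F E c v 2 χv s ≠ 0)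
    (hl : lF F E v χv (2 * s) ≠ 0) (X : ℂ) :
    aNorm F E c v 2 χv vol s * ((vol : ℂ)⁻¹ * bDen F E c v 2 χv s * lF F E v χv (2 * s + 1) * lF F E v χv (2 * s) * X) =
      lF F E v χv (2 * s + 1) * lEN F E c v χv (2 * s) * lF F E v χv (2 * s - 1) * X := by
  have hvolC : (vol : ℂ) ≠ 0 := Complex.ofReal_ne_zero.2 hvol
  rw [aNorm_def, aNum_two]
  field_simp

/-! ## §2 Non-vanishing on `−½ < re s` for unitary `χ_v` -/

/-- `lEN(z) ≠ 0` for `0 < re z` and unitary `χ_v`. [cite: Tate1950, §2.5] -/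
theorem lEN_ne_zero (hχ : ∀ (w : PlacesOver E v) (x : (w.1.adicCompletion E)ˣ), ‖((χv w x : ℂˣ) : ℂ)‖ = 1) {z : ℂ} (hz : 0 < z.re) :
    lEN F E c v χv z ≠ 0 := by
  unfold lEN
  exact Finset.prod_ne_zero_iff.2 fun w _ => lFactor_ne_zero (norm_unramValue_le_one (norm_chiNorm_eq_one hχ w)) hz

/-- **`b_2(s) ≠ 0` for `−½ < re s`** and unitary `χ_v`. [cite: KudlaSweet1997, §1] -/
theorem bDen_two_ne_zero (hχ : ∀ (w : PlacesOver E v) (x : (w.1.adicCompletion E)ˣ), ‖((χv w x : ℂˣ) : ℂ)‖ = 1) {s : ℂ}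
    (hs : -(1 / 2 : ℝ) < s.re) : bDen F E c v 2 χv s ≠ 0 := by
  rw [bDen_two]
  have h1 : 0 < (2 * s + 1).re := by simp [Complex.add_re, Complex.mul_re]; linarith
  have h2 : 0 < (2 * s + 2).re := by simp [Complex.add_re, Complex.mul_re]; linarith
  exact mul_ne_zero (lF_ne_zero hχ h2) (div_ne_zero (lEN_ne_zero c χv hχ h1) (lF_ne_zero hχ h1))

/-- `lF(2s) ≠ 0` for `0 < re s` and unitary `χ_v`. [cite: Tate1950, §2.5] -/
theorem lF_two_mul_ne_zero (hχ : ∀ (w : PlacesOver E v) (x : (w.1.adicCompletion E)ˣ), ‖((χv w x : ℂˣ) : ℂ)‖ = 1) {s : ℂ}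
    (hs : 0 < s.re) : lF F E v χv (2 * s) ≠ 0 :=
  lF_ne_zero hχ (by simp [Complex.mul_re]; linarith)

/-- **`M = a_w · Fn` on the convergence half-plane**: for `1 < re s` (indeed `0 < re s`), unitary `χ_v` and `vol ≠ 0`, any quantity of the form
`c₀ · lF(2s+1) · lEN(2s) · lF(2s−1) · G` equals `aNorm 2 χv vol s · (vol⁻¹ · b_2(s) · lF(2s+1) · lF(2s) · (c₀ · G))`.
[cite: HarrisKudlaSweet1996, §6 (6.14)–(6.16)] [cite: KudlaSweet1997, §1] -/
theorem eq_aNorm_two_mul (hχ : ∀ (w : PlacesOver E v) (x : (w.1.adicCompletion E)ˣ), ‖((χv w x : ℂˣ) : ℂ)‖ = 1) {vol : ℝ} (hvol : vol ≠ 0)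
    {s : ℂ} (hs : 0 < s.re) (c₀ G : ℂ) :
    c₀ * lF F E v χv (2 * s + 1) * lEN F E c v χv (2 * s) * lF F E v χv (2 * s - 1) * G =
      aNorm F E c v 2 χv vol s *
        ((vol : ℂ)⁻¹ * bDen F E c v 2 χv s * lF F E v χv (2 * s + 1) * lF F E v χv (2 * s) * (c₀ * G)) := by
  rw [aNorm_two_mul_normalisedFactor c χv hvol (bDen_two_ne_zero c χv hχ (by linarith)) (lF_two_mul_ne_zero χv hχ hs)]
  ring

/-! ## §3 Regularity of the normalised factor at `½` -/

/-- **`s ↦ vol⁻¹ · b_2(s) · lF(2s+1) · lF(2s) · X(s)` is regular at `½`** when `X` is (unitary `χ_v`). [cite: KudlaSweet1997, §1] -/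
theorem isQRationalRegularAt_normalisedFactor (hχ : ∀ (w : PlacesOver E v) (x : (w.1.adicCompletion E)ˣ), ‖((χv w x : ℂˣ) : ℂ)‖ = 1)
    (vol : ℝ) {X : ℂ → ℂ} (hX : IsQRationalRegularAt (residueFieldCard (v.adicCompletion F)) (1 / 2) X) :
    IsQRationalRegularAt (residueFieldCard (v.adicCompletion F)) (1 / 2) fun s =>
      (vol : ℂ)⁻¹ * bDen F E c v 2 χv s * lF F E v χv (2 * s + 1) * lF F E v χv (2 * s) * X s := by
  have h1 := isQRationalRegularAt_lF_two_mul_add_nat (v := v) hχ 1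
  have h0 := isQRationalRegularAt_lF_two_mul_add_nat (v := v) hχ 0
  simp only [Nat.cast_one, Nat.cast_zero, add_zero] at h1 h0
  exact ((((isQRationalRegularAt_bDen_half c hχ 2).const_mul _).mul h1).mul h0).mul hX

end Summit.HodgeConjecture.HodgeConjecture.Cruxes.HLiu418.K2LiuA7NormaliserAlgebra

end
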